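import Summits.BirchSwinnertonDyer.BirchSwinnertonDyer.Theorems.ByReductionTypeAtTwoRankOneAtTwoBigImageOddLocalOneDoorGlue
import Literature.NumberTheory.EllipticCurves.NonvanishingTwistsWaldspurgerOfHoffsteinLuo
import Literature.NumberTheory.EllipticCurves.NonvanishingTwistsProofs
import Literature.NumberTheory.EllipticCurves.BSDRootNumberModularityOnlyProofs
import Literature.NumberTheory.EllipticCurves.NoConductorOne
import HarnessLib

/-!
# Route ByReductionTypeAtTwo, crux `RankOneAtTwoBigImageOddLocal` (stmt-BirchSwinnertonDyer-23715), LINE v8 `one_door_analytic`: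
# the Hoffstein–Luo DOOR SUPPLY and the GLUE with `s_d` floating, as tree theorems (no route file imported)

Lead prover seat `bsd-line-fkl-p1` g6 (2026-08-28), adopting the analytic lens' LINE v8.1 `one_door_analytic` (planner
`bsd-f1-sign2-an` g11, MEMO-an v1.21 AN-28) as the line of record for the crux.  The two theorems of this file are the planner's
§1 and §3 of `Cruxes/RankOneAtTwoBigImageOddLocal/Lines/one_door_analytic.lean` v8.1 (kernel-checked there), moved VERBATIM into
`Theorems/` against the tree names of `…OneDoorLawDefs.lean` (APPEND #3, p617185) so that the skeleton's stubs can cite them: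

* `doorSupplyAnalyticAtTwo_of_pubHL : S_pubHL → DoorSupplyAnalyticAtTwo` — for `W` of analytic rank one, `w(W) = −1`
  (modularity), Hoffstein–Luo gives a square-free `d ≡ 1 (8)` with `(d/ℓ) = 1` at the odd bad primes and `L(W^{(d)},1) ≠ 0`,
  `d < 0` by the sign of the twist (tree `exists_neg_fundamental_twist_ne_zero_of_hoffsteinLuo`), and `K = ℚ(√d)`
  (tree `exists_heegnerField_iff_exists_fundamental`) is a door field: every prime of `d` is prime to `N`, hence good
  (tree `hasGoodReductionAtPrime_of_not_dvd_conductorNorm'`).  The Mazur–Rubin `Sel₂`-trivialising supply of v7 is not needed.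
* `doorGlueAn : S_doorGlueAn` — `S_pub → DoorIndexLawFullAtTwo → DoorTwinValueAtTwo → DoorSupplyAnalyticAtTwo → S_manin →
  S_sliceMW`: the lead's `stub_doorGlue` (p611607) with `s_d = ord₂ #Ш(Wd)[2^∞]` carried on both sides of the door
  `P2.bsdp_two_iff_of_heegner_rankOne` (it cancels).

Credit: proofs by planner -an g11 (v8.1); the lead only re-homed them.  BSD is not proved by any of this: `S_pubHL`/`S_pub` are
PRINT named facts, `DoorIndexLawFullAtTwo` is the lens' CONJECTURE, `DoorTwinValueAtTwo` follows from the route's own rank-`0`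
cruxes (open items) by the kernel twist arithmetic (width seat fkl-p2 g6, p616165 / p616880), `S_manin` is open for `4 ∣ N`.
-/

set_option autoImplicit false

noncomputable section

open scoped Classical

set_option linter.dupNamespace false

namespace Summit.BirchSwinnertonDyer.BirchSwinnertonDyer.Theorems.RankOneAtTwoOneDoor

open WeierstrassCurve NumberField IsDedekindDomain Rat.HeightOneSpectrum Literature.NumberTheory.EllipticCurves
  Literature.NumberTheory.EllipticCurves.ModularForms
  Literature.NumberTheory.EllipticCurves.KrizLi2019
  Summit.BirchSwinnertonDyer.Rank1Residual.F1Sign2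
  Summit.BirchSwinnertonDyer.Rank1Residual.F1Sign2.TranspositionDoor
  Summit.BirchSwinnertonDyer.Rank1Residual

/-! ### §1 The supply is a theorem modulo PRINT: Hoffstein–Luo's `d` is a door (-an g11, v8.1 §1) -/

/-- **`S_pubHL → DoorSupplyAnalyticAtTwo`**: for `W` of analytic rank one, `w(W) = −1` (Modularity:
`even_analyticRank_iff_rootNumber_eq_one_of_exists_isNewformOf`); Hoffstein–Luo with the bad primes adjoined gives a square-free
`d ≡ 1 (8)`, `(d/ℓ) = 1` at every odd `ℓ ∣ N`, `L(W^{(d)},1) ≠ 0`, and `d < 0` by the sign of the twist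
(`exists_neg_fundamental_twist_ne_zero_of_hoffsteinLuo`); `K = ℚ(√d)` (`exists_heegnerField_iff_exists_fundamental`) is imaginary
quadratic with `d_K = d` and the Heegner hypothesis; every prime of `d` is prime to `N`, hence good. -/
theorem doorSupplyAnalyticAtTwo_of_pubHL : S_pubHL → DoorSupplyAnalyticAtTwo := by
  rintro ⟨hmod, hHL⟩ W _ _ _ hr
  set N : ℕ := W.conductorNorm ℤ with hN_def
  have hN0 : N ≠ 0 := (W.conductorNorm_pos_holds).ne'
  -- the sign
  have hw : W.rootNumber = -1 := by
    have hiff : Even W.analyticRank ↔ W.rootNumber = 1 :=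
      even_analyticRank_iff_rootNumber_eq_one_of_exists_isNewformOf W hmod
    rcases rootNumber_eq_one_or_eq_neg_one W with h1 | h1
    · exfalso
      have hev : Even W.analyticRank := hiff.mpr h1
      rw [hr] at hev
      exact Nat.not_even_one hev
    · exact h1
  -- Hoffstein–Luo's negative square-free `d ≡ 1 (8)` with `(d/ℓ) = 1` at the odd bad primes and `L(W^{(d)}, 1) ≠ 0`
  obtain ⟨d, hdneg, hsq, hd8, -, -, hjacN, hL⟩ :=
    exists_neg_fundamental_twist_ne_zero_of_hoffsteinLuo hmod hHL W hw ∅ 0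
  have hd0 : d ≠ 0 := hdneg.ne
  -- no prime of `N` divides `d`
  have hndvd : ∀ p : ℕ, p.Prime → p ∣ N → ¬ (p : ℤ) ∣ d := by
    intro p hp hpN hpd
    by_cases hp2 : p = 2
    · subst hp2
      have : d % 2 = 0 := Int.emod_eq_zero_of_dvd (by exact_mod_cast hpd)
      omega
    · have hj : jacobiSym d p = 1 := hjacN p hp hpN hp2
      rw [jacobiSym.mod_left, Int.emod_eq_zero_of_dvd hpd, jacobiSym.zero_left hp.one_lt] at hj
      exact zero_ne_one hj
  -- the field `K = ℚ(√d)`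
  obtain ⟨K, _iF, _iN, hK, -, hHN, hdK⟩ :=
    (exists_heegnerField_iff_exists_fundamental N 0 (fun D => D = d)).mpr
      ⟨d, hdneg, Or.inl ⟨by omega, hsq, by omega⟩, by simpa using Int.natAbs_pos.mpr hd0 |>.ne',
        fun p hp hpN => ⟨fun _ => hd8, fun hp2 => hjacN p hp hpN hp2⟩, rfl⟩
  refine ⟨K, _iF, _iN, hK, ?_, ?_, ?_, hHN⟩
  · -- door-admissible
    rw [hdK]
    refine ⟨hdneg, hsq, hd8, ?_, ?_⟩
    · intro q hq hqd _hF
      have hqN : ¬ q ∣ N := fun hqN => hndvd q hq hqN hqd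
      exact hasGoodReductionAtPrime_of_not_dvd_conductorNorm' W hqN
    · intro ℓ hℓ hℓ2 hbad
      by_cases hℓN : ℓ ∣ N
      · exact hjacN ℓ hℓ hℓN hℓ2
      · exact absurd (hasGoodReductionAtPrime_of_not_dvd_conductorNorm' W (hℓ := ⟨hℓ⟩) hℓN) (hbad ⟨hℓ⟩)
  · -- `L(W^{(d_K)}, 1) ≠ 0`
    rw [hdK]; exact hL
  · -- `(d_K, N) = 1`
    rw [hdK]
    exact Nat.coprime_of_dvd fun p hp hpd hpN => hndvd p hp hpN (Int.ofNat_dvd_left.mpr hpd)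


/-! ### §3 THE GLUE, PROVED (`s_d` carried on both sides; pattern = the lead's `stub_doorGlue`, p611607) -/

/-- `S_pub → DoorIndexLawFullAtTwo → DoorTwinValueAtTwo → DoorSupplyAnalyticAtTwo → S_manin → S_sliceMW`.
[cite: GrossZagier1986, Thm. I.6.3 and V.§2] [cite: Pal2012, Prop. 2.5 and Cor. 2.6] -/
theorem doorGlueAn : S_doorGlueAn := by
  intro hpub hIdx hVal hSup hMan W _ _ hCM hsurj hT hc hr hrk
  haveI : Fact (Nat.Prime 2) := ⟨Nat.prime_two⟩
  haveI hN : NeZero (W.conductorNorm ℤ) := ⟨(W.conductorNorm_pos_holds).ne'⟩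
  set N : ℕ := W.conductorNorm ℤ with hN_def
  -- `E(ℚ)[2] = 0`
  have hT2 : NoRationalTwoTorsion W := noRationalTwoTorsion_of_odd_torsionOrder W hT
  -- the door field (Waldspurger–Hoffstein–Luo): admissible, `L(E^{(d_K)},1) ≠ 0`, Heegner
  obtain ⟨K, _iF, _iN, hK, hadm, hLt, -, hHN⟩ := hSup W hr
  have h2 : Module.finrank ℚ K = 2 := hK.1
  haveI : IsTotallyComplex K := hK.2
  -- the odd-constant parametrisation, the Heegner datum, an embedding, the `K`-rational Heegner point
  obtain ⟨Dt, hcodd⟩ := hMan W hT2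
  obtain ⟨H, -⟩ := nonempty_heegnerDatum_holds N K hK (exists_dvd_sq_sub_discr_holds N K hK hHN).choose_spec
  obtain ⟨ι⟩ : Nonempty (K →+* ℂ) := inferInstance
  obtain ⟨hGZ, hKo, hrat⟩ := hpub.1 N W K
  have hGZK : rank_eq_analyticRank_of_analyticRank_le_one := hpub.2.1
  have hmod : hasEntireLFunction_rat := hpub.2.2
  obtain ⟨P, hP⟩ := hrat hK hHN Dt H ι
  -- the minimal twist model and the value law (rank-`0` `BSD₂` of the twin, `s_d` floating)
  have hD0 : (NumberField.discr K : ℚ) ≠ 0 := by exact_mod_cast NumberField.discr_ne_zero K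
  haveI hEt : (W.quadraticTwist (NumberField.discr K : ℚ)).IsElliptic := W.isElliptic_quadraticTwist hD0
  obtain ⟨Cd, hCd⟩ := hasGlobalMinimalModel_rat_holds (W.quadraticTwist (NumberField.discr K : ℚ))
  haveI : (Cd • W.quadraticTwist (NumberField.discr K : ℚ)).IsGloballyMinimal := hCd
  set Wd := Cd • W.quadraticTwist (NumberField.discr K : ℚ) with hWd_def
  have hWd : Cd • W.quadraticTwist (NumberField.discr K : ℚ) = Wd := rfl
  obtain ⟨hfinWd, qd, hqd, hqd0, hvqd⟩ := hVal W hCM hT2 (NumberField.discr K) hadm hLt Wd Cd hWd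
  set sd : ℕ := padicValNat 2 (Nat.card (AddCommGroup.primaryComponent Wd.sha 2)) with hsd_def
  -- the door index law at `(K, Dt, H, ι, P, Wd)`
  obtain ⟨m, ⟨Q, hPQ, hQ⟩, hlaw⟩ :=
    hIdx W hCM hsurj hT hc hr K hK hadm hLt Dt H ι P hP hcodd Wd Cd hWd
  -- the door
  have hc0 : Dt.c ≠ 0 := by
    intro h0; apply hcodd; rw [h0]; exact dvd_zero _
  obtain ⟨k, hk12, hkiff, hdoor⟩ :=
    P2.bsdp_two_iff_of_heegner_rankOne W N K Dt H ι P hGZ hKo hGZK hmod hK hHN hP hc0 hr hLt Wd Cd hWd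
      qd hqd
  apply hdoor.mpr
  ------------------------------------------------------------------ rank `E(K) = 1`, `Ш(E)` finite (as inside the door)
  haveI hEK : (W.baseChange K).IsElliptic := isElliptic_baseChange' W K
  have hL0 : W.entireLFunction 1 = 0 := entireLFunction_one_eq_zero_of_analyticRank_eq_one hr
  obtain ⟨-, hderiv⟩ := leadingLCoeff_eq_deriv_of_analyticRank_eq_one hr
  have hprod := lDerivEK_eq_deriv_mul W K hmod hL0
  have hLK : LDerivEK W K ≠ 0 := by rw [hprod]; exact mul_ne_zero hderiv hLt
  have hPH : IsHeegnerPoint N W K P := ⟨Dt, H, ι, hP⟩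
  have hPinf : ¬ IsOfFinAddOrder P :=
    (lDerivEK_ne_zero_iff_not_isOfFinAddOrder W N K hGZ hK hHN hPH).mp hLK
  obtain ⟨hrkK, hShaK⟩ := hKo hK hHN hPH hPinf
  have hShaW : W.ShaFinite := Literature.NumberTheory.EllipticCurves.shaFinite_of_baseChange W K hShaK
  haveI hfinW : Finite W.sha := hShaW
  ------------------------------------------------------------------ `#E(K)_tors` odd, `k = 1`
  have htKodd : Odd (W.baseChange K).torsionOrder := odd_torsionOrder_baseChange_of_noRationalTwoTorsion W hT2 K h2
  have hk1 : k = 1 := by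
    rcases hk12 with h | h
    · exact h
    · exact absurd (hkiff.mp h) (P2.not_forall_halvable_of_odd_torsionOrder W K h2 hrkK hrk htKodd)
  ------------------------------------------------------------------ the index of `P`
  obtain ⟨gK, hgK, hgenK, -, -⟩ :=
    exists_generator_regulator_eq_of_mordellWeilRank_eq_one (W.baseChange K) hrkK
  have hQ' : ¬ ∃ Q' : (W.baseChange K).toAffine.Point,
      Q - 2 • Q' ∈ AddCommGroup.torsion (W.baseChange K).toAffine.Point := hQ
  obtain ⟨hI0, hvIdx⟩ := padicValNat_index_of_twoDivisibility (W.baseChange K) hgK hgenK hPQ hQ'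
  have hvtK : padicValNat 2 (W.baseChange K).torsionOrder = 0 :=
    padicValNat.eq_zero_of_not_dvd (fun h => (Nat.not_even_iff_odd.mpr htKodd) (even_iff_two_dvd.mpr h))
  ------------------------------------------------------------------ `w_K = 2`, `|u| = 1`
  have hw2 : Units.torsionOrder K = 2 :=
    Literature.NumberTheory.QuadraticFields.Quadratic.torsionOrder_eq_two_of_discr_lt_neg_four h2
      (discr_lt_neg_four_of_doorAdmissible hadm)
  have hu1 : |(Cd.u : ℚ)| = 1 := by
    rcases W.u_eq_one_or_eq_neg_one_of_smul_quadraticTwist_of_squarefree (emod_four_of_doorAdmissible hadm)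
        hadm.2.1 (good_or_mult_at_dvd_of_doorAdmissible W hadm) Wd Cd hWd with h | h <;> rw [h] <;> simp
  ------------------------------------------------------------------ oddness of `c_W`
  have hvcWn : padicValNat 2 W.tamagawaProduct = 0 :=
    padicValNat.eq_zero_of_not_dvd (fun h => (Nat.not_even_iff_odd.mpr hc) (even_iff_two_dvd.mpr h))
  ------------------------------------------------------------------ the valuation, factor by factor
  have hΔ0 : W.Δ ≠ 0 := W.isUnit_Δ.ne_zero
  have hI' : ((AddSubgroup.zmultiples P).index : ℚ) ≠ 0 := by exact_mod_cast hI0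
  have htW' : (W.torsionOrder : ℚ) ≠ 0 := by exact_mod_cast (W.torsionOrder_pos_holds).ne'
  have htK' : ((W.baseChange K).torsionOrder : ℚ) ≠ 0 := by
    exact_mod_cast ((W.baseChange K).torsionOrder_pos_holds).ne'
  have hcW' : (W.tamagawaProduct : ℚ) ≠ 0 := by exact_mod_cast (W.tamagawaProduct_pos_holds).ne'
  have hcM : (Dt.c : ℚ) ≠ 0 := by exact_mod_cast hc0
  have hw' : (Units.torsionOrder K : ℚ) ≠ 0 := by rw [hw2]; norm_num
  have hua : |(Cd.u : ℚ)| ≠ 0 := abs_ne_zero.mpr Cd.u.ne_zero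
  have hk' : ((k : ℕ) : ℚ) ≠ 0 := by rw [hk1]; norm_num
  have hn12 : (W.baseChange ℝ).numRealComponents = 1 ∨ (W.baseChange ℝ).numRealComponents = 2 :=
    numRealComponents_eq_one_or W
  have hn' : ((W.baseChange ℝ).numRealComponents : ℚ) ≠ 0 := by
    rcases hn12 with h | h <;> rw [h] <;> norm_num
  -- valuations of the single factors
  have h8 : padicValRat 2 (8 : ℚ) = 3 := by
    rw [show (8 : ℚ) = ((2 : ℕ) : ℚ) ^ 3 by norm_num, padicValRat.pow, padicValRat.self one_lt_two]; norm_num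
  have hvI : padicValRat 2 ((AddSubgroup.zmultiples P).index : ℚ) = (m : ℤ) := by
    rw [padicValRat.of_nat, hvIdx, hvtK]; push_cast; ring
  have hvtW : padicValRat 2 (W.torsionOrder : ℚ) = 0 := by
    rw [padicValRat.of_nat, padicValNat.eq_zero_of_not_dvd
      (fun h => (Nat.not_even_iff_odd.mpr hT) (even_iff_two_dvd.mpr h))]; rfl
  have hvtKq : padicValRat 2 ((W.baseChange K).torsionOrder : ℚ) = 0 := by
    rw [padicValRat.of_nat, hvtK]; rfl
  have hvcW : padicValRat 2 (W.tamagawaProduct : ℚ) = 0 := by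
    rw [padicValRat.of_nat, hvcWn]; rfl
  have hvc : padicValRat 2 (Dt.c : ℚ) = 0 := by
    rw [padicValRat.of_int, padicValInt.eq_zero_of_not_dvd hcodd]; rfl
  have hvw : padicValRat 2 (Units.torsionOrder K : ℚ) = 1 := by
    rw [hw2]; exact padicValRat.self one_lt_two
  have hvu : padicValRat 2 |(Cd.u : ℚ)| = 0 := by rw [hu1]; exact padicValRat.one
  have hvk : padicValRat 2 ((k : ℕ) : ℚ) = 0 := by
    rw [hk1, Nat.cast_one]; exact padicValRat.one
  have hvqd' : padicValRat 2 qd =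
      (transpCount W (NumberField.discr K) : ℤ) + 2 * (identCount W (NumberField.discr K) : ℤ) + (sd : ℤ) := by
    rw [hvqd, hvcWn, hsd_def]; push_cast; ring
  -- numerator and denominator
  have hA1 : (8 : ℚ) * ((AddSubgroup.zmultiples P).index : ℚ) ^ 2 ≠ 0 :=
    mul_ne_zero (by norm_num) (pow_ne_zero _ hI')
  have hA2 : (8 : ℚ) * ((AddSubgroup.zmultiples P).index : ℚ) ^ 2 * (W.torsionOrder : ℚ) ^ 2 ≠ 0 :=
    mul_ne_zero hA1 (pow_ne_zero _ htW')
  have hD1 : ((W.baseChange ℝ).numRealComponents : ℚ) * ((k : ℕ) : ℚ) ^ 2 ≠ 0 :=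
    mul_ne_zero hn' (pow_ne_zero _ hk')
  have hD2 : ((W.baseChange ℝ).numRealComponents : ℚ) * ((k : ℕ) : ℚ) ^ 2 *
      ((W.baseChange K).torsionOrder : ℚ) ^ 2 ≠ 0 := mul_ne_zero hD1 (pow_ne_zero _ htK')
  have hD3 : ((W.baseChange ℝ).numRealComponents : ℚ) * ((k : ℕ) : ℚ) ^ 2 *
      ((W.baseChange K).torsionOrder : ℚ) ^ 2 * (Dt.c : ℚ) ^ 2 ≠ 0 := mul_ne_zero hD2 (pow_ne_zero _ hcM)
  have hD4 : ((W.baseChange ℝ).numRealComponents : ℚ) * ((k : ℕ) : ℚ) ^ 2 *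
      ((W.baseChange K).torsionOrder : ℚ) ^ 2 * (Dt.c : ℚ) ^ 2 * (Units.torsionOrder K : ℚ) ^ 2 ≠ 0 :=
    mul_ne_zero hD3 (pow_ne_zero _ hw')
  have hD5 : ((W.baseChange ℝ).numRealComponents : ℚ) * ((k : ℕ) : ℚ) ^ 2 *
      ((W.baseChange K).torsionOrder : ℚ) ^ 2 * (Dt.c : ℚ) ^ 2 * (Units.torsionOrder K : ℚ) ^ 2 * qd ≠ 0 :=
    mul_ne_zero hD4 hqd0
  have hD6 : ((W.baseChange ℝ).numRealComponents : ℚ) * ((k : ℕ) : ℚ) ^ 2 *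
      ((W.baseChange K).torsionOrder : ℚ) ^ 2 * (Dt.c : ℚ) ^ 2 * (Units.torsionOrder K : ℚ) ^ 2 * qd *
      |(Cd.u : ℚ)| ≠ 0 := mul_ne_zero hD5 hua
  have hD7 : ((W.baseChange ℝ).numRealComponents : ℚ) * ((k : ℕ) : ℚ) ^ 2 *
      ((W.baseChange K).torsionOrder : ℚ) ^ 2 * (Dt.c : ℚ) ^ 2 * (Units.torsionOrder K : ℚ) ^ 2 * qd *
      |(Cd.u : ℚ)| * (W.tamagawaProduct : ℚ) ≠ 0 := mul_ne_zero hD6 hcW'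
  have hnum : padicValRat 2 ((8 : ℚ) * ((AddSubgroup.zmultiples P).index : ℚ) ^ 2 * (W.torsionOrder : ℚ) ^ 2) =
      3 + 2 * (m : ℤ) := by
    rw [padicValRat.mul hA1 (pow_ne_zero _ htW'), padicValRat.mul (by norm_num) (pow_ne_zero _ hI'),
      padicValRat.pow, padicValRat.pow, h8, hvI, hvtW]
    ring
  have hden : padicValRat 2 (((W.baseChange ℝ).numRealComponents : ℚ) * ((k : ℕ) : ℚ) ^ 2 *
      ((W.baseChange K).torsionOrder : ℚ) ^ 2 * (Dt.c : ℚ) ^ 2 * (Units.torsionOrder K : ℚ) ^ 2 * qd *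
      |(Cd.u : ℚ)| * (W.tamagawaProduct : ℚ)) =
      padicValRat 2 ((W.baseChange ℝ).numRealComponents : ℚ) + 2 +
        ((transpCount W (NumberField.discr K) : ℤ) + 2 * (identCount W (NumberField.discr K) : ℤ) + (sd : ℤ)) := by
    rw [padicValRat.mul hD6 hcW', padicValRat.mul hD5 hua, padicValRat.mul hD4 hqd0,
      padicValRat.mul hD3 (pow_ne_zero _ hw'), padicValRat.mul hD2 (pow_ne_zero _ hcM),
      padicValRat.mul hD1 (pow_ne_zero _ htK'), padicValRat.mul hn' (pow_ne_zero _ hk'),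
      padicValRat.pow, padicValRat.pow, padicValRat.pow, padicValRat.pow,
      hvk, hvtKq, hvc, hvw, hvqd', hvu, hvcW]
    ring
  have hprim : padicValNat 2 (Nat.card (AddCommGroup.primaryComponent W.sha 2)) =
      padicValNat 2 (Nat.card W.sha) := padicValNat_card_addPrimaryComponent 2
  rw [padicValRat.div hA2 hD7, hnum, hden, ← hprim]
  -- the law, by the sign of `Δ`
  rcases lt_or_gt_of_ne hΔ0 with hneg | hpos
  · rw [if_pos hneg] at hlaw
    rw [P2.numRealComponents_eq_one_of_Δ_neg hneg, Nat.cast_one, padicValRat.one]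
    have hlawZ : (2 * m + 1 : ℤ) =
        (padicValNat 2 (Nat.card (AddCommGroup.primaryComponent W.sha 2)) : ℤ) + (sd : ℤ) +
          transpCount W (NumberField.discr K) + 2 * identCount W (NumberField.discr K) := by
      rw [hsd_def]; exact_mod_cast hlaw
    omega
  · rw [if_neg (not_lt.mpr hpos.le), add_zero] at hlaw
    rw [P2.numRealComponents_eq_two_of_Δ_pos hpos, show ((2 : ℕ) : ℚ) = ((2 : ℕ) : ℚ) from rfl,
      padicValRat.self one_lt_two]
    have hlawZ : (2 * m : ℤ) =
        (padicValNat 2 (Nat.card (AddCommGroup.primaryComponent W.sha 2)) : ℤ) + (sd : ℤ) +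
          transpCount W (NumberField.discr K) + 2 * identCount W (NumberField.discr K) := by
      rw [hsd_def]; exact_mod_cast hlaw
    omega


end Summit.BirchSwinnertonDyer.BirchSwinnertonDyer.Theorems.RankOneAtTwoOneDoor

end
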